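import Mathlib
import Summits.AtomisticToContinuum.HydrodynamicLimit.Theorems.ImplosionDichotomyDenseExcursionPackingAnalyticSonicApriori
import Summits.AtomisticToContinuum.HydrodynamicLimit.Theorems.ImplosionDichotomyDenseExcursionPackingAnalyticSonicExistenceStep
import Literature.Analysis.ODE.HolomorphicLinearODEStarConvex

/-!
# EXISTENCE of the bounded holomorphic solution of the order-`k` packing problem on the complex sonic triangle
# (crux `DenseExcursion`, stmt-AtomisticToContinuum-12586, line `sonic-cavity-renewal` v9, stub `stub_analyticPackingImplosion`)

Helper file (`--supports stmt-AtomisticToContinuum-12586`, line lead a2, wave-5 worker D2, task `sonicWindow_analytic_bound`,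
worker report `work/stubs/D2_triangle.REPORT.md`). For `Λ ≥ Λ₀`, `ρ ≤ ρ₀`, holomorphic bounded sources `f₁, f₂` on the sonic
triangle `𝒟_ρ` and a prescribed value `m₀` of the regular characteristic `M = U₁ − 3U₂` at the sonic point, the complexified
resolvent system `Λ U − L_ℂ U = f` has a BOUNDED HOLOMORPHIC solution on `𝒟_ρ` (`sonicTriangle_holomorphic_existence`,
REGISTERED helper). Construction: Picard iteration `(P_{n+1}, M_{n+1}) = (T_{Λ/κ}[H(P_n, M_n)], transport(P_n; m₀))`
(`eulerResolvent_holomorphic_bound`, `exists_holomorphic_linearODE_of_starConvex`), contraction by `1/2` in the weighted norm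
`e^{−K‖z‖}`, `K = Λ + 5C_β` (`euler_step_weighted`, `transport_step_weighted`), uniform geometric convergence
(`geometric_uniform_limit`), holomorphy of the limit and convergence of derivatives (`TendstoLocallyUniformlyOn.differentiableOn`,
`.deriv`), and the inverse characteristic change of variables.

Sources: Coddington–Levinson 1955 Ch. 1 §3, Ch. 4 §2; Nirenberg 1972. NOT here: the identification with the real solution.
-/

noncomputable section

open Set Metric Filter Topology

namespace Summit.AtomisticToContinuum.HydrodynamicLimit.Theorems.PackingAnalyticImplosion

open Summit.AtomisticToContinuum.HydrodynamicLimit.Theorems.R2OneModeTwoConditions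
open Summit.AtomisticToContinuum.HydrodynamicLimit.Theorems.SonicCavityRenewal
open Literature.Analysis.ODE

set_option maxHeartbeats 1600000 in -- one declaration: Picard iteration, contraction, limit and identification of the equations
/-- **EXISTENCE OF THE BOUNDED HOLOMORPHIC SOLUTION ON THE SONIC TRIANGLE** (registered helper
`sonicTriangle_holomorphic_existence` of `stub_analyticPackingImplosion`). [folklore] -/
theorem sonicTriangle_holomorphic_existence : ∀ (r : ℝ) (W S : ℝ → ℝ) (Wc Sc : ℂ → ℂ), IsMonatomicProfile r W S → CavityTube r W S → AnalyticOnNhd ℂ Wc (Metric.ball 0 (1 / 10)) → AnalyticOnNhd ℂ Sc (Metric.ball 0 (1 / 10)) → (∀ x : ℝ, |x| < 1 / 10 → Wc (x : ℂ) = ((W x : ℝ) : ℂ) ∧ Sc (x : ℂ) = ((S x : ℝ) : ℂ) ∧ deriv Wc (x : ℂ) = ((deriv W x : ℝ) : ℂ) ∧ deriv Sc (x : ℂ) = ((deriv S x : ℝ) : ℂ)) → ∃ (ρ₀ Λ₀ : ℝ), 0 < ρ₀ ∧ 0 < Λ₀ ∧ ∀ (Λ ρ : ℝ), Λ₀ ≤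 Λ → 0 < ρ → ρ ≤ ρ₀ → ∀ (f₁ f₂ : ℂ → ℂ) (m₀ : ℂ), DifferentiableOn ℂ f₁ {z : ℂ | -(3 * ρ) < z.re ∧ z.re < ρ ∧ |z.im| < (z.re + 3 * ρ) / 2} → DifferentiableOn ℂ f₂ {z : ℂ | -(3 * ρ) < z.re ∧ z.re < ρ ∧ |z.im| < (z.re + 3 * ρ) / 2} → (∃ Nf : ℝ, ∀ z ∈ {z : ℂ | -(3 * ρ) < z.re ∧ z.re < ρ ∧ |z.im| < (z.re + 3 * ρ) / 2}, ‖f₁ z‖ ≤ Nf ∧ ‖f₂ z‖ ≤ Nf) → ∃ U₁ U₂ : ℂ → ℂ, DifferentiableOn ℂ U₁ {z : ℂ | -(3 * ρ) < z.re ∧ z.re < ρ ∧ |z.im| < (z.re + 3 * ρ) / 2} ∧ DifferentiableOn ℂ U₂ {z : ℂ | -(3 * ρ) < z.re ∧ z.re < ρ ∧ |z.im| < (z.re + 3 * ρ) / 2} ∧ (∃ K : ℝ, ∀ z ∈ {z : ℂ | -(3 * ρ) < z.re ∧ z.re < ρ ∧ |z.im| < (z.re + 3 * ρ) / 2}, ‖U₁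 z‖ ≤ K ∧ ‖U₂ z‖ ≤ K) ∧ U₁ 0 - 3 * U₂ 0 = m₀ ∧ ∀ z ∈ {z : ℂ | -(3 * ρ) < z.re ∧ z.re < ρ ∧ |z.im| < (z.re + 3 * ρ) / 2}, (Λ : ℂ) * U₁ z - ((Wc z - 1) * deriv U₁ z + 3 * Sc z * deriv U₂ z + (deriv Wc z + 2 * Wc z - r) * U₁ z + (3 * deriv Sc z + 6 * Sc z) * U₂ z) = f₁ z ∧ (Λ : ℂ) * U₂ z - (Sc z / 3 * deriv U₁ z + (Wc z - 1) * deriv U₂ z + (deriv Sc z + 2 * Sc z) * U₁ z + (deriv Wc z / 3 + 2 * Wc z - r) * U₂ z) = f₂ z := by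
  intro r W S Wc Sc hprof htube hWc hSc hext
  obtain ⟨R₀, κ, Cb, Ce, d, e, hR₀, hR₀le, hκ, hCb, hCe, hdd, hed, hfac, hd0, hbnd⟩ :=
    sonicTriangle_profile r W S Wc Sc hprof htube hWc hSc hext
  have hr2 : r < 2 := by
    have h3 : (1 : ℝ) < Real.sqrt 3 := by rw [show (1 : ℝ) = Real.sqrt 1 by simp]; exact Real.sqrt_lt_sqrt (by norm_num) (by norm_num)
    linarith [hprof.2.1]
  have hrabs : |r| ≤ 2 := by rw [abs_of_pos (by linarith [hprof.1])]; exact hr2.le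
  have hκ0 : 0 < κ := by linarith
  set Cβ : ℝ := 9 * Cb + 2 with hCβ
  have hCβ2 : 2 ≤ Cβ := by simp only [hCβ]; linarith
  refine ⟨min (R₀ / 3) (κ / (24 * (Ce + 1))), 50 * Cβ, lt_min (by linarith) (by positivity), by linarith, ?_⟩
  intro Λ ρ hΛ hρ hρ₀ f₁ f₂ m₀ hf₁ hf₂ hNf
  obtain ⟨Nf, hNf⟩ := hNf
  have hΛ0 : 0 < Λ := by linarith
  have hρR : 3 * ρ ≤ R₀ := by linarith [min_le_left (R₀ / 3) (κ / (24 * (Ce + 1)))]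
  have hρκ : ρ ≤ κ / (24 * (Ce + 1)) := hρ₀.trans (min_le_right _ _)
  -- the triangle
  set D : Set ℂ := {z : ℂ | -(3 * ρ) < z.re ∧ z.re < ρ ∧ |z.im| < (z.re + 3 * ρ) / 2} with hD
  have hDo : IsOpen D := isOpen_sonicTriangle ρ; have h0D : (0 : ℂ) ∈ D := zero_mem_sonicTriangle hρ
  have hDst : StarConvex ℝ (0 : ℂ) D := starConvex_sonicTriangle h0D
  have hDball : ∀ w ∈ D, w ∈ ball (0 : ℂ) R₀ := fun w hw => by
    rw [mem_ball, dist_zero_right]; exact (norm_lt_of_mem_sonicTriangle hw).trans_le hρR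
  have hDsub : D ⊆ ball (0 : ℂ) (1 / 10) := fun w hw => ball_subset_ball hR₀le (hDball w hw)
  have hnormD : ∀ w ∈ D, ‖w‖ ≤ 3 * ρ := fun w hw => (norm_lt_of_mem_sonicTriangle hw).le
  have hNf0 : 0 ≤ Nf := le_trans (norm_nonneg _) (hNf 0 h0D).1
  -- holomorphic coefficients
  have hWd : DifferentiableOn ℂ Wc D := hWc.differentiableOn.mono hDsub; have hSd : DifferentiableOn ℂ Sc D := hSc.differentiableOn.mono hDsub
  have hWd' : DifferentiableOn ℂ (deriv Wc) D := (hWc.deriv).differentiableOn.mono hDsub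
  have hSd' : DifferentiableOn ℂ (deriv Sc) D := (hSc.deriv).differentiableOn.mono hDsub; have hdD : DifferentiableOn ℂ d D := hdd.mono hDsub
  set bpp : ℂ → ℂ := fun z => 2 / 3 * deriv Wc z + 2 * Wc z - (r : ℂ) + 2 * deriv Sc z + 4 * Sc z with hbpp
  set bpm : ℂ → ℂ := fun z => deriv Wc z / 3 + deriv Sc z + 2 * Sc z with hbpm
  set bmm : ℂ → ℂ := fun z => 2 / 3 * deriv Wc z + 2 * Wc z - (r : ℂ) - 2 * deriv Sc z - 4 * Sc z with hbmm
  set bmp : ℂ → ℂ := fun z => deriv Wc z / 3 - deriv Sc z - 2 * Sc z with hbmp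
  set cm : ℂ → ℂ := fun z => Wc z - 1 - Sc z with hcm
  have hcoef : ∀ w ∈ D, ‖bpp w‖ ≤ Cβ ∧ ‖bpm w‖ ≤ Cβ ∧ ‖bmm w‖ ≤ Cβ ∧ ‖bmp w‖ ≤ Cβ ∧
      (cm w).re ≤ -1 ∧ (d w).re ≤ -(κ / 2) ∧ ‖e w‖ ≤ Ce := by
    intro w hw
    obtain ⟨h1, -, h3, h4, -, -, h7, h8, h9, h10⟩ := hbnd w (hDball w hw)
    obtain ⟨b1, b2, b3, b4⟩ := norm_charCoeff_le hCb h7 h8 h9 h10 hrabs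
    exact ⟨b1, b2, b3, b4, h4, h1, h3⟩
  have hcm_ne : ∀ w ∈ D, cm w ≠ 0 := fun w hw h => by have := (hcoef w hw).2.2.2.2.1; rw [h] at this; norm_num at this
  have hcm_norm : ∀ w ∈ D, 1 ≤ ‖cm w‖ := fun w hw => by
    have h1 := (hcoef w hw).2.2.2.2.1; have h2 := Complex.abs_re_le_norm (cm w)
    have h3 : 1 ≤ |(cm w).re| := (by rw [abs_of_nonpos (by linarith)]; linarith); linarith
  have hd_ne : ∀ w ∈ D, d w ≠ 0 := fun w hw h => by have := (hcoef w hw).2.2.2.2.2.1; rw [h] at this; norm_num at this; linarith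
  have hd_norm : ∀ w ∈ D, κ / 2 ≤ ‖d w‖ := fun w hw => by
    have h1 := (hcoef w hw).2.2.2.2.2.1; have h2 := Complex.abs_re_le_norm (d w)
    have h3 : κ / 2 ≤ |(d w).re| := (by rw [abs_of_nonpos (by linarith)]; linarith); linarith
  have hbpp_d : DifferentiableOn ℂ bpp D := (by simp only [hbpp]; fun_prop); have hbpm_d : DifferentiableOn ℂ bpm D := (by simp only [hbpm]; fun_prop)
  have hbmm_d : DifferentiableOn ℂ bmm D := (by simp only [hbmm]; fun_prop); have hbmp_d : DifferentiableOn ℂ bmp D := (by simp only [hbmp]; fun_prop)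
  have hcm_d : DifferentiableOn ℂ cm D := by simp only [hcm]; fun_prop
  -- the operators of the iteration
  set a₀ : ℝ := Λ / κ with ha₀; have ha₀pos : 0 < a₀ := div_pos hΛ0 hκ0
  set g : ℂ → ℂ := fun w => ((Λ : ℂ) - bmm w) / cm w with hg
  have hg_d : DifferentiableOn ℂ g D := by
    simp only [hg]; exact DifferentiableOn.fun_div (by fun_prop) hcm_d hcm_ne
  set Hf : (ℂ → ℂ) → (ℂ → ℂ) → ℂ → ℂ := fun Q Nn w =>
    (a₀ : ℂ) * Q w + (((Λ : ℂ) - bpp w) * Q w - bpm w * Nn w - (f₁ w + 3 * f₂ w)) / d w with hHf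
  set bsrc : (ℂ → ℂ) → ℂ → ℂ := fun Q w => -(bmp w * Q w + (f₁ w - 3 * f₂ w)) / cm w with hbsrc
  have hHf_d : ∀ Q Nn : ℂ → ℂ, DifferentiableOn ℂ Q D → DifferentiableOn ℂ Nn D → DifferentiableOn ℂ (Hf Q Nn) D := by
    intro Q Nn hQ hN
    simp only [hHf]
    exact (hQ.const_mul _).fun_add (DifferentiableOn.fun_div (by fun_prop) hdD hd_ne)
  have hbsrc_d : ∀ Q : ℂ → ℂ, DifferentiableOn ℂ Q D → DifferentiableOn ℂ (bsrc Q) D := by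
    intro Q hQ
    simp only [hbsrc]
    exact DifferentiableOn.fun_div (by fun_prop) hcm_d hcm_ne
  -- one Picard step
  have hstep : ∀ Q Nn : ℂ → ℂ, DifferentiableOn ℂ Q D → DifferentiableOn ℂ Nn D → ∃ Q' N' : ℂ → ℂ,
      DifferentiableOn ℂ Q' D ∧ DifferentiableOn ℂ N' D ∧ (∀ w ∈ D, w * deriv Q' w + a₀ * Q' w = Hf Q Nn w) ∧
      (∀ w ∈ D, HasDerivAt N' (g w * N' w + bsrc Q w) w) ∧ N' 0 = m₀ := by
    intro Q Nn hQ hN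
    obtain ⟨Q', hQ'd, hQ'eq, -⟩ := eulerResolvent_holomorphic_bound a₀ D (Hf Q Nn) ha₀pos hDo hDst (hHf_d Q Nn hQ hN)
    have hA : DifferentiableOn ℂ (fun w => g w • (1 : ℂ →L[ℂ] ℂ)) D := hg_d.smul_const _
    obtain ⟨N', hN'd, hN'0, hN'eq⟩ := exists_holomorphic_linearODE_of_starConvex (E := ℂ) hDo hDst hA (hbsrc_d Q hQ) m₀
    exact ⟨Q', N', hQ'd, hN'd, hQ'eq, fun w hw => by simpa using hN'eq w hw, hN'0⟩
  choose! stepP stepM hstepP hstepM hstepEq hstepDer hstep0 using hstep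
  -- the iteration
  set Φ : (ℂ → ℂ) × (ℂ → ℂ) → (ℂ → ℂ) × (ℂ → ℂ) := fun x => (stepP x.1 x.2, stepM x.1 x.2) with hΦ
  set X : ℕ → (ℂ → ℂ) × (ℂ → ℂ) := fun n => Φ^[n] ((fun _ => 0), (fun _ => 0)) with hX
  have hX0 : X 0 = ((fun _ => 0), (fun _ => 0)) := rfl
  have hXs : ∀ n, X (n + 1) = (stepP (X n).1 (X n).2, stepM (X n).1 (X n).2) := fun n => by
    simp only [hX]; rw [Function.iterate_succ_apply']
  set Pn : ℕ → ℂ → ℂ := fun n => (X n).1 with hPn; set Mn : ℕ → ℂ → ℂ := fun n => (X n).2 with hMn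
  have hPs : ∀ n, Pn (n + 1) = stepP (Pn n) (Mn n) := fun n => by simp only [hPn, hMn, hXs]
  have hMs : ∀ n, Mn (n + 1) = stepM (Pn n) (Mn n) := fun n => by simp only [hPn, hMn, hXs]
  have hdiff : ∀ n, DifferentiableOn ℂ (Pn n) D ∧ DifferentiableOn ℂ (Mn n) D := by
    intro n
    induction n with
    | zero => exact ⟨by simp only [hPn, hX0]; exact differentiableOn_const _,
        by simp only [hMn, hX0]; exact differentiableOn_const _⟩
    | succ n ih =>
      rw [hPs, hMs]
      exact ⟨hstepP _ _ ih.1 ih.2, hstepM _ _ ih.1 ih.2⟩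
  have hEq : ∀ n, ∀ w ∈ D, w * deriv (Pn (n + 1)) w + a₀ * Pn (n + 1) w = Hf (Pn n) (Mn n) w := fun n w hw => by
    rw [hPs]; exact hstepEq _ _ (hdiff n).1 (hdiff n).2 w hw
  have hDer : ∀ n, ∀ w ∈ D, HasDerivAt (Mn (n + 1)) (g w * Mn (n + 1) w + bsrc (Pn n) w) w := fun n w hw => by
    rw [hMs]; exact hstepDer _ _ (hdiff n).1 (hdiff n).2 w hw
  have hM0 : ∀ n, Mn (n + 1) 0 = m₀ := fun n => by rw [hMs]; exact hstep0 _ _ (hdiff n).1 (hdiff n).2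
  -- the weighted contraction
  set K : ℝ := (Λ + Cβ) + 4 * Cβ with hK
  have hK0 : 0 ≤ K := by simp only [hK]; nlinarith
  have hgL : ∀ w ∈ D, ‖g w‖ ≤ Λ + Cβ := fun w hw => by
    simp only [hg]; rw [norm_div]
    calc ‖(Λ : ℂ) - bmm w‖ / ‖cm w‖ ≤ ‖(Λ : ℂ) - bmm w‖ / 1 :=
          div_le_div_of_nonneg_left (norm_nonneg _) one_pos (hcm_norm w hw)
      _ ≤ Λ + Cβ := by
          rw [div_one]
          refine (norm_sub_le _ _).trans ?_
          rw [Complex.norm_real, Real.norm_eq_abs, abs_of_pos hΛ0]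
          linarith [(hcoef w hw).2.2.1]
  set ε₁ : ℝ := 8 * Nf / Λ + ‖m₀‖ + Nf / Cβ with hε₁
  have hρCe : 6 * ρ * Ce / κ ≤ 1 / 4 := by
    rw [div_le_div_iff₀ hκ0 (by norm_num)]
    have h1 : ρ * (24 * (Ce + 1)) ≤ κ := (le_div_iff₀ (by positivity)).1 hρκ
    nlinarith
  have hCβΛ : Cβ / Λ ≤ 1 / 50 := by rw [div_le_div_iff₀ hΛ0 (by norm_num)]; linarith
  -- differences of `Hf` and of `bsrc`
  have hHf_diff : ∀ (Q Q' Nn N' : ℂ → ℂ) (ε : ℝ), (∀ w ∈ D, ‖Q w - Q' w‖ ≤ ε * Real.exp (K * ‖w‖)) →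
      (∀ w ∈ D, ‖Nn w - N' w‖ ≤ ε * Real.exp (K * ‖w‖)) → 0 ≤ ε →
      ∀ w ∈ D, ‖Hf Q Nn w - Hf Q' N' w‖ ≤ (6 * ρ * Λ * Ce / κ ^ 2 + 4 * Cβ / κ) * ε * Real.exp (K * ‖w‖) := by
    intro Q Q' Nn N' ε hQ hN hε w hw
    obtain ⟨hbpp_le, hbpm_le, -, -, -, hdre, hen⟩ := hcoef w hw
    have hdw := hd_ne w hw
    have hκc : (κ : ℂ) ≠ 0 := Complex.ofReal_ne_zero.2 hκ0.ne'
    set E : ℝ := ε * Real.exp (K * ‖w‖) with hE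
    have hE0 : 0 ≤ E := by positivity
    have hrew : Hf Q Nn w - Hf Q' N' w = ((a₀ : ℂ) + (Λ : ℂ) / d w) * (Q w - Q' w) -
        (bpp w * (Q w - Q' w) + bpm w * (Nn w - N' w)) / d w := by
      simp only [hHf]; field_simp; ring
    have hsmall : (a₀ : ℂ) + (Λ : ℂ) / d w = (Λ : ℂ) * (w * e w) / ((κ : ℂ) * d w) := by
      have h2 := (hfac w (hDsub hw)).2
      rw [hd0] at h2
      have h3 : w * e w = d w + κ := by rw [← h2]; ring
      rw [h3]; simp only [ha₀]; push_cast; field_simp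
    have hsmall_norm : ‖(a₀ : ℂ) + (Λ : ℂ) / d w‖ ≤ 6 * ρ * Λ * Ce / κ ^ 2 := by
      rw [hsmall, norm_div, norm_mul, norm_mul, norm_mul, Complex.norm_real, Complex.norm_real, Real.norm_eq_abs,
        Real.norm_eq_abs, abs_of_pos hΛ0, abs_of_pos hκ0, div_le_div_iff₀ (by positivity) (by positivity)]
      have h1 : ‖w‖ * ‖e w‖ ≤ 3 * ρ * Ce := mul_le_mul (hnormD w hw) hen (norm_nonneg _) (by positivity)
      have h2 : κ ^ 2 ≤ κ * ‖d w‖ * 2 := by nlinarith [hd_norm w hw]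
      calc Λ * (‖w‖ * ‖e w‖) * κ ^ 2 ≤ Λ * (3 * ρ * Ce) * (κ * ‖d w‖ * 2) :=
            mul_le_mul (mul_le_mul_of_nonneg_left h1 hΛ0.le) h2 (by positivity) (by positivity)
        _ = 6 * ρ * Λ * Ce * (κ * ‖d w‖) := by ring
    have hsecond : ‖(bpp w * (Q w - Q' w) + bpm w * (Nn w - N' w)) / d w‖ ≤ 4 * Cβ / κ * E := by
      rw [norm_div]
      have hnum : ‖bpp w * (Q w - Q' w) + bpm w * (Nn w - N' w)‖ ≤ Cβ * E + Cβ * E :=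
        norm_add_le_of_le (norm_mul_le_of_le hbpp_le (hQ w hw) (by linarith))
          (norm_mul_le_of_le hbpm_le (hN w hw) (by linarith))
      calc ‖bpp w * (Q w - Q' w) + bpm w * (Nn w - N' w)‖ / ‖d w‖ ≤ (Cβ * E + Cβ * E) / (κ / 2) := by
            gcongr; exact hd_norm w hw
        _ = 4 * Cβ / κ * E := by field_simp; ring
    rw [hrew]
    calc ‖((a₀ : ℂ) + (Λ : ℂ) / d w) * (Q w - Q' w) - (bpp w * (Q w - Q' w) + bpm w * (Nn w - N' w)) / d w‖
        ≤ 6 * ρ * Λ * Ce / κ ^ 2 * E + 4 * Cβ / κ * E :=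
          norm_sub_le_of_le (norm_mul_le_of_le hsmall_norm (hQ w hw) (by positivity)) hsecond
      _ = (6 * ρ * Λ * Ce / κ ^ 2 + 4 * Cβ / κ) * ε * Real.exp (K * ‖w‖) := by simp only [hE]; ring
  have hbsrc_diff : ∀ (Q Q' : ℂ → ℂ) (ε : ℝ), (∀ w ∈ D, ‖Q w - Q' w‖ ≤ ε * Real.exp (K * ‖w‖)) → 0 ≤ ε →
      ∀ w ∈ D, Real.exp (-(K * ‖w‖)) * ‖bsrc Q w - bsrc Q' w‖ ≤ Cβ * ε := by
    intro Q Q' ε hQ hε w hw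
    obtain ⟨-, -, -, hbmp_le, -⟩ := hcoef w hw
    have hrew : bsrc Q w - bsrc Q' w = -(bmp w * (Q w - Q' w)) / cm w := by
      simp only [hbsrc]; field_simp; ring
    rw [hrew, norm_div, norm_neg]
    have h1 : ‖bmp w * (Q w - Q' w)‖ / ‖cm w‖ ≤ Cβ * (ε * Real.exp (K * ‖w‖)) := by
      calc ‖bmp w * (Q w - Q' w)‖ / ‖cm w‖ ≤ ‖bmp w * (Q w - Q' w)‖ / 1 :=
            div_le_div_of_nonneg_left (norm_nonneg _) one_pos (hcm_norm w hw)
        _ ≤ Cβ * (ε * Real.exp (K * ‖w‖)) := by rw [div_one]; exact norm_mul_le_of_le hbmp_le (hQ w hw) (by linarith)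
    have hexp : Real.exp (-(K * ‖w‖)) * Real.exp (K * ‖w‖) = 1 := by rw [← Real.exp_add]; simp
    calc Real.exp (-(K * ‖w‖)) * (‖bmp w * (Q w - Q' w)‖ / ‖cm w‖)
        ≤ Real.exp (-(K * ‖w‖)) * (Cβ * (ε * Real.exp (K * ‖w‖))) := mul_le_mul_of_nonneg_left h1 (Real.exp_pos _).le
      _ = Cβ * ε := by linear_combination Cβ * ε * hexp
  -- the geometric decay of the differences
  have hgeom : ∀ n, ∀ w ∈ D, ‖Pn (n + 1) w - Pn n w‖ ≤ ε₁ * (1 / 2) ^ n * Real.exp (K * ‖w‖) ∧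
      ‖Mn (n + 1) w - Mn n w‖ ≤ ε₁ * (1 / 2) ^ n * Real.exp (K * ‖w‖) := by
    intro n
    induction n with
    | zero =>
      intro w hw
      have hP0 : Pn 0 = fun _ => 0 := by simp only [hPn, hX0]
      have hM00 : Mn 0 = fun _ => 0 := by simp only [hMn, hX0]
      have hew : 1 ≤ Real.exp (K * ‖w‖) := Real.one_le_exp (by positivity)
      -- `P₁`
      have hG : ∀ w ∈ D, ‖Hf (Pn 0) (Mn 0) w‖ ≤ 8 * Nf / κ * 1 * Real.exp (K * ‖w‖) := by
        intro w hw
        obtain ⟨hf1, hf2⟩ := hNf w hw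
        have hew' : 1 ≤ Real.exp (K * ‖w‖) := Real.one_le_exp (by positivity)
        have h1 : Hf (Pn 0) (Mn 0) w = -(f₁ w + 3 * f₂ w) / d w := by simp only [hHf, hP0, hM00]; ring
        rw [h1, norm_div, norm_neg]
        have h4 : ‖f₁ w + 3 * f₂ w‖ ≤ 4 * Nf := by
          calc ‖f₁ w + 3 * f₂ w‖ ≤ ‖f₁ w‖ + ‖(3 : ℂ) * f₂ w‖ := norm_add_le _ _
            _ ≤ 4 * Nf := by rw [norm_mul]; norm_num; linarith
        calc ‖f₁ w + 3 * f₂ w‖ / ‖d w‖ ≤ 4 * Nf / (κ / 2) := by gcongr; exact hd_norm w hw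
          _ = 8 * Nf / κ * 1 * 1 := by field_simp; ring
          _ ≤ 8 * Nf / κ * 1 * Real.exp (K * ‖w‖) := by gcongr
      have hP1 := euler_step_weighted a₀ (8 * Nf / κ) K 1 D (Hf (Pn 0) (Mn 0)) (Pn 1) ha₀pos hK0 hDo hDst (hdiff 1).1
        (hEq 0) hG w hw
      -- `M₁`
      have hF : ∀ w ∈ D, Real.exp (-(K * ‖w‖)) * ‖bsrc (Pn 0) w‖ ≤ 4 * Nf := by
        intro w hw
        obtain ⟨hf1, hf2⟩ := hNf w hw
        have h1 : bsrc (Pn 0) w = -(f₁ w - 3 * f₂ w) / cm w := by simp only [hbsrc, hP0]; ring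
        rw [h1, norm_div, norm_neg]
        have h4 : ‖f₁ w - 3 * f₂ w‖ / ‖cm w‖ ≤ 4 * Nf := by
          calc ‖f₁ w - 3 * f₂ w‖ / ‖cm w‖ ≤ ‖f₁ w - 3 * f₂ w‖ / 1 :=
                div_le_div_of_nonneg_left (norm_nonneg _) one_pos (hcm_norm w hw)
            _ ≤ 4 * Nf := by
                rw [div_one]
                calc ‖f₁ w - 3 * f₂ w‖ ≤ ‖f₁ w‖ + ‖(3 : ℂ) * f₂ w‖ := norm_sub_le _ _
                  _ ≤ 4 * Nf := by rw [norm_mul]; norm_num; linarith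
        have hle1 : Real.exp (-(K * ‖w‖)) ≤ 1 := Real.exp_le_one_iff.2 (by nlinarith [norm_nonneg w])
        calc Real.exp (-(K * ‖w‖)) * (‖f₁ w - 3 * f₂ w‖ / ‖cm w‖) ≤ 1 * (4 * Nf) :=
              mul_le_mul hle1 h4 (by positivity) zero_le_one
          _ = 4 * Nf := one_mul _
      have hM1 := transport_step_weighted (Λ + Cβ) Cβ K (4 * Nf) D g (bsrc (Pn 0)) (Mn 1) (by linarith) (by simp only [hK])
        hDst hgL (hDer 0) hF w hw
      rw [hM0 0] at hM1
      have hexpK : 0 < Real.exp (K * ‖w‖) := Real.exp_pos _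
      have hexp1 : Real.exp (-(K * ‖w‖)) * Real.exp (K * ‖w‖) = 1 := by rw [← Real.exp_add]; simp
      rw [hP0, hM00]
      simp only [sub_zero, pow_zero, mul_one]
      constructor
      · calc ‖Pn 1 w‖ ≤ 8 * Nf / κ / a₀ * 1 * Real.exp (K * ‖w‖) := hP1
          _ = 8 * Nf / Λ * Real.exp (K * ‖w‖) := by simp only [ha₀]; field_simp
          _ ≤ ε₁ * Real.exp (K * ‖w‖) := by gcongr; simp only [hε₁]; linarith [norm_nonneg m₀, div_nonneg hNf0 (by linarith : (0:ℝ) ≤ Cβ)]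
      · have h2 : ‖Mn 1 w‖ ≤ (‖m₀‖ + 4 * Nf / (4 * Cβ)) * Real.exp (K * ‖w‖) := by
          have := mul_le_mul_of_nonneg_right hM1 hexpK.le
          calc ‖Mn 1 w‖ = Real.exp (-(K * ‖w‖)) * ‖Mn 1 w‖ * Real.exp (K * ‖w‖) := by
                rw [mul_comm (Real.exp _) ‖Mn 1 w‖, mul_assoc, hexp1, mul_one]
            _ ≤ (‖m₀‖ + 4 * Nf / (4 * Cβ)) * Real.exp (K * ‖w‖) := this
        calc ‖Mn 1 w‖ ≤ (‖m₀‖ + 4 * Nf / (4 * Cβ)) * Real.exp (K * ‖w‖) := h2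
          _ ≤ ε₁ * Real.exp (K * ‖w‖) := by
              gcongr
              have : 4 * Nf / (4 * Cβ) = Nf / Cβ := by field_simp
              simp only [hε₁]; rw [this]; linarith [div_nonneg (by positivity : (0:ℝ) ≤ 8 * Nf) hΛ0.le]
    | succ n ih =>
      intro w hw
      have hεn : 0 ≤ ε₁ * (1 / 2) ^ n := by positivity
      have hQ : ∀ w ∈ D, ‖Pn (n + 1) w - Pn n w‖ ≤ ε₁ * (1 / 2) ^ n * Real.exp (K * ‖w‖) := fun w hw => (ih w hw).1
      have hN : ∀ w ∈ D, ‖Mn (n + 1) w - Mn n w‖ ≤ ε₁ * (1 / 2) ^ n * Real.exp (K * ‖w‖) := fun w hw => (ih w hw).2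
      -- the Euler difference
      have hYd : DifferentiableOn ℂ (fun w => Pn (n + 2) w - Pn (n + 1) w) D := (hdiff (n + 2)).1.fun_sub (hdiff (n + 1)).1
      have hYeq : ∀ w ∈ D, w * deriv (fun w => Pn (n + 2) w - Pn (n + 1) w) w + a₀ * (Pn (n + 2) w - Pn (n + 1) w) =
          Hf (Pn (n + 1)) (Mn (n + 1)) w - Hf (Pn n) (Mn n) w := by
        intro w hw
        have hd1 : deriv (fun w => Pn (n + 2) w - Pn (n + 1) w) w = deriv (Pn (n + 2)) w - deriv (Pn (n + 1)) w :=
          deriv_fun_sub ((hdiff (n + 2)).1.differentiableAt (hDo.mem_nhds hw))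
            ((hdiff (n + 1)).1.differentiableAt (hDo.mem_nhds hw))
        rw [hd1]
        linear_combination hEq (n + 1) w hw - hEq n w hw
      have hG := hHf_diff (Pn (n + 1)) (Pn n) (Mn (n + 1)) (Mn n) _ hQ hN hεn
      have hP := euler_step_weighted a₀ (6 * ρ * Λ * Ce / κ ^ 2 + 4 * Cβ / κ) K (ε₁ * (1 / 2) ^ n) D _ _ ha₀pos hK0
        hDo hDst hYd hYeq hG w hw
      -- the transport difference
      have hDer2 : ∀ w ∈ D, HasDerivAt (fun w => Mn (n + 2) w - Mn (n + 1) w)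
          (g w * (Mn (n + 2) w - Mn (n + 1) w) + (bsrc (Pn (n + 1)) w - bsrc (Pn n) w)) w := by
        intro w hw
        exact ((hDer (n + 1) w hw).fun_sub (hDer n w hw)).congr_deriv (by ring)
      have hF := hbsrc_diff (Pn (n + 1)) (Pn n) _ hQ hεn
      have hM := transport_step_weighted (Λ + Cβ) Cβ K (Cβ * (ε₁ * (1 / 2) ^ n)) D g _ _ (by linarith)
        (by simp only [hK]) hDst hgL hDer2 hF w hw
      simp only [hM0, sub_self, norm_zero, zero_add] at hM
      have hexpK : 0 < Real.exp (K * ‖w‖) := Real.exp_pos _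
      have hexp1 : Real.exp (-(K * ‖w‖)) * Real.exp (K * ‖w‖) = 1 := by rw [← Real.exp_add]; simp
      have hratio : (6 * ρ * Λ * Ce / κ ^ 2 + 4 * Cβ / κ) / a₀ ≤ 1 / 2 := by
        have he : (6 * ρ * Λ * Ce / κ ^ 2 + 4 * Cβ / κ) / a₀ = 6 * ρ * Ce / κ + 4 * (Cβ / Λ) := by
          simp only [ha₀]; field_simp
        rw [he]; linarith
      constructor
      · calc ‖Pn (n + 1 + 1) w - Pn (n + 1) w‖
            ≤ (6 * ρ * Λ * Ce / κ ^ 2 + 4 * Cβ / κ) / a₀ * (ε₁ * (1 / 2) ^ n) * Real.exp (K * ‖w‖) := hP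
          _ ≤ 1 / 2 * (ε₁ * (1 / 2) ^ n) * Real.exp (K * ‖w‖) := by gcongr
          _ = ε₁ * (1 / 2) ^ (n + 1) * Real.exp (K * ‖w‖) := by ring
      · have h2 : ‖Mn (n + 2) w - Mn (n + 1) w‖ ≤ Cβ * (ε₁ * (1 / 2) ^ n) / (4 * Cβ) * Real.exp (K * ‖w‖) := by
          have := mul_le_mul_of_nonneg_right hM hexpK.le
          calc ‖Mn (n + 2) w - Mn (n + 1) w‖
              = Real.exp (-(K * ‖w‖)) * ‖Mn (n + 2) w - Mn (n + 1) w‖ * Real.exp (K * ‖w‖) := by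
                rw [mul_comm (Real.exp _) ‖_‖, mul_assoc, hexp1, mul_one]
            _ ≤ Cβ * (ε₁ * (1 / 2) ^ n) / (4 * Cβ) * Real.exp (K * ‖w‖) := this
        calc ‖Mn (n + 1 + 1) w - Mn (n + 1) w‖ ≤ Cβ * (ε₁ * (1 / 2) ^ n) / (4 * Cβ) * Real.exp (K * ‖w‖) := h2
          _ = 1 / 4 * (ε₁ * (1 / 2) ^ n) * Real.exp (K * ‖w‖) := by field_simp
          _ ≤ 1 / 2 * (ε₁ * (1 / 2) ^ n) * Real.exp (K * ‖w‖) := by gcongr; norm_num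
          _ = ε₁ * (1 / 2) ^ (n + 1) * Real.exp (K * ‖w‖) := by ring
  -- uniform geometric convergence
  set EK : ℝ := Real.exp (K * (3 * ρ)) with hEK
  have hwEK : ∀ w ∈ D, Real.exp (K * ‖w‖) ≤ EK := fun w hw =>
    Real.exp_le_exp.2 (mul_le_mul_of_nonneg_left (hnormD w hw) hK0)
  have hε₁0 : 0 ≤ ε₁ := by simp only [hε₁]; positivity
  have hgeomP : ∀ n, ∀ w ∈ D, ‖Pn (n + 1) w - Pn n w‖ ≤ ε₁ * EK * (1 / 2) ^ n := fun n w hw => by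
    calc ‖Pn (n + 1) w - Pn n w‖ ≤ ε₁ * (1 / 2) ^ n * Real.exp (K * ‖w‖) := (hgeom n w hw).1
      _ ≤ ε₁ * (1 / 2) ^ n * EK := by gcongr; exact hwEK w hw
      _ = ε₁ * EK * (1 / 2) ^ n := by ring
  have hgeomM : ∀ n, ∀ w ∈ D, ‖Mn (n + 1) w - Mn n w‖ ≤ ε₁ * EK * (1 / 2) ^ n := fun n w hw => by
    calc ‖Mn (n + 1) w - Mn n w‖ ≤ ε₁ * (1 / 2) ^ n * Real.exp (K * ‖w‖) := (hgeom n w hw).2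
      _ ≤ ε₁ * (1 / 2) ^ n * EK := by gcongr; exact hwEK w hw
      _ = ε₁ * EK * (1 / 2) ^ n := by ring
  obtain ⟨Pl, hPl, hPtail⟩ := geometric_uniform_limit D Pn (ε₁ * EK) hgeomP
  obtain ⟨Ml, hMl, hMtail⟩ := geometric_uniform_limit D Mn (ε₁ * EK) hgeomM
  have hPloc := hPl.tendstoLocallyUniformlyOn; have hMloc := hMl.tendstoLocallyUniformlyOn
  have hevP : ∀ᶠ n in atTop, DifferentiableOn ℂ (Pn n) D := Eventually.of_forall fun n => (hdiff n).1
  have hevM : ∀ᶠ n in atTop, DifferentiableOn ℂ (Mn n) D := Eventually.of_forall fun n => (hdiff n).2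
  have hPld : DifferentiableOn ℂ Pl D := hPloc.differentiableOn hevP hDo; have hMld : DifferentiableOn ℂ Ml D := hMloc.differentiableOn hevM hDo
  have hPder := hPloc.deriv hevP hDo; have hMder := hMloc.deriv hevM hDo
  -- pointwise limits
  have tP : ∀ w ∈ D, Tendsto (fun n => Pn n w) atTop (𝓝 (Pl w)) := fun w hw => hPl.tendsto_at hw; have tM : ∀ w ∈ D, Tendsto (fun n => Mn n w) atTop (𝓝 (Ml w)) := fun w hw => hMl.tendsto_at hw
  have tP' : ∀ w ∈ D, Tendsto (fun n => deriv (Pn n) w) atTop (𝓝 (deriv Pl w)) := fun w hw => hPder.tendsto_at hw; have tM' : ∀ w ∈ D, Tendsto (fun n => deriv (Mn n) w) atTop (𝓝 (deriv Ml w)) := fun w hw => hMder.tendsto_at hw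
  have hshift : ∀ {u : ℕ → ℂ} {a : ℂ}, Tendsto u atTop (𝓝 a) → Tendsto (fun n => u (n + 1)) atTop (𝓝 a) :=
    fun h => h.comp (tendsto_add_atTop_nat 1)
  -- the limit equations
  have hPleq : ∀ w ∈ D, w * deriv Pl w + a₀ * Pl w = Hf Pl Ml w := by
    intro w hw
    have h1 : Tendsto (fun n => w * deriv (Pn (n + 1)) w + a₀ * Pn (n + 1) w) atTop (𝓝 (w * deriv Pl w + a₀ * Pl w)) :=
      ((hshift (tP' w hw)).const_mul w).add ((hshift (tP w hw)).const_mul (a₀ : ℂ))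
    have h2 : Tendsto (fun n => Hf (Pn n) (Mn n) w) atTop (𝓝 (Hf Pl Ml w)) := by
      simp only [hHf]
      exact ((tP w hw).const_mul _).add (((((tP w hw).const_mul _).sub ((tM w hw).const_mul _)).sub_const _).div_const _)
    exact tendsto_nhds_unique (h1.congr fun n => hEq n w hw) h2
  have hMleq : ∀ w ∈ D, deriv Ml w = g w * Ml w + bsrc Pl w := by
    intro w hw
    have h1 : Tendsto (fun n => deriv (Mn (n + 1)) w) atTop (𝓝 (deriv Ml w)) := hshift (tM' w hw)
    have h2 : Tendsto (fun n => g w * Mn (n + 1) w + bsrc (Pn n) w) atTop (𝓝 (g w * Ml w + bsrc Pl w)) := by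
      refine ((hshift (tM w hw)).const_mul _).add ?_
      simp only [hbsrc]
      exact (((tP w hw).const_mul _).add_const _).neg.div_const _
    exact tendsto_nhds_unique (h1.congr fun n => (hDer n w hw).deriv) h2
  have hMl0 : Ml 0 = m₀ := by
    have h1 : Tendsto (fun n => Mn (n + 1) 0) atTop (𝓝 (Ml 0)) := hshift (tM 0 h0D)
    have h2 : Tendsto (fun n => Mn (n + 1) 0) atTop (𝓝 m₀) := by simp only [hM0]; exact tendsto_const_nhds
    exact tendsto_nhds_unique h1 h2
  -- back to `U₁`, `U₂`
  refine ⟨fun z => (Pl z + Ml z) / 2, fun z => (Pl z - Ml z) / 6, (hPld.fun_add hMld).div_const _,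
    (hPld.fun_sub hMld).div_const _, ⟨2 * (ε₁ * EK), fun z hz => ?_⟩, ?_, fun z hz => ?_⟩
  · have hP0 : Pn 0 = fun _ => 0 := by simp only [hPn, hX0]
    have hM00 : Mn 0 = fun _ => 0 := by simp only [hMn, hX0]
    have h1 := hPtail 0 z hz; have h2 := hMtail 0 z hz
    rw [hP0] at h1; rw [hM00] at h2
    simp only [zero_sub, norm_neg, pow_zero, mul_one] at h1 h2
    constructor
    · rw [norm_div]; norm_num; linarith [norm_add_le (Pl z) (Ml z)]
    · rw [norm_div]; norm_num; linarith [norm_sub_le (Pl z) (Ml z), norm_nonneg (Pl z)]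
  · simp only; rw [hMl0]; ring
  · have hPd : HasDerivAt Pl (deriv Pl z) z := (hPld.differentiableAt (hDo.mem_nhds hz)).hasDerivAt
    have hMd : HasDerivAt Ml (deriv Ml z) z := (hMld.differentiableAt (hDo.mem_nhds hz)).hasDerivAt
    have hd1 : deriv (fun z => (Pl z + Ml z) / 2) z = (deriv Pl z + deriv Ml z) / 2 := ((hPd.add hMd).div_const 2).deriv
    have hd2 : deriv (fun z => (Pl z - Ml z) / 6) z = (deriv Pl z - deriv Ml z) / 6 := ((hPd.sub hMd).div_const 6).deriv
    rw [hd1, hd2]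
    have hdz := hd_ne z hz; have hcz := hcm_ne z hz; have hP1 := hPleq z hz; have hM1 := hMleq z hz
    have hfac1 := (hfac z (hDsub hz)).1
    -- clear denominators in the two limit equations
    have hP2 : z * d z * deriv Pl z = ((Λ : ℂ) - bpp z) * Pl z - bpm z * Ml z - (f₁ z + 3 * f₂ z) := by
      simp only [hHf] at hP1
      field_simp at hP1
      linear_combination hP1
    have hM2 : cm z * deriv Ml z = ((Λ : ℂ) - bmm z) * Ml z - bmp z * Pl z - (f₁ z - 3 * f₂ z) := by
      rw [hM1]; simp only [hg, hbsrc]; field_simp; ring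
    rw [← hfac1] at hP2
    simp only [hbpp, hbpm, hbmm, hbmp, hcm] at hP2 hM2
    constructor
    · linear_combination (-(1 / 2) : ℂ) * hP2 + (-(1 / 2) : ℂ) * hM2
    · linear_combination (-(1 / 6) : ℂ) * hP2 + (1 / 6 : ℂ) * hM2

end Summit.AtomisticToContinuum.HydrodynamicLimit.Theorems.PackingAnalyticImplosion

end
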